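import Literature.AnabelianGeometry.EtaleTheta.ContH1CoeffChange
import Literature.AnabelianGeometry.EtaleTheta.ContH1Discrete
import HarnessLib

/-!
# Continuous `H¹`: transport along a change of the action homomorphism with the SAME action
# (support file for [EtTh] §1; semi-synthetic models of the §1 root)

Neukirch–Schmidt–Wingberg, *Cohomology of Number Fields*, I §2 / II §7: `H¹(H, A)` depends on the
`H`-MODULE `A` only [cite: NeukirchSchmidtWingberg2008, I §2 and II §7]. In the tree's concrete carrier
`ContH1 φ A H` (`ContH1.lean`, abc-iut-L2-t1: continuous crossed homomorphisms `H → A` for the conjugation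
action of `G` on the abelian normal `A ≤ G'` THROUGH `φ : G →* G'`) the homomorphism `φ` is part of the
TYPE, so two homomorphisms `φ, φ' : G →* G'` inducing the same conjugation on `A` over `H` — e.g. `φ` and
`φ' := φ ∘ s ∘ π` for a section `s` of a quotient `π` whose kernel centralises `A` ([EtTh] §1 p. 12: `Δ_Θ`
is central in `(Δ^tp_X)^Θ`, so the action of `(Π^tp_Ÿ)^Θ` on `Δ_Θ` factors through `G_K̈`) — give
different types with literally the same cocycles and coboundaries. This file supplies the transport:

* `contCocycles_congr`, `contCoboundaries_congr` — equality of the cocycle / coboundary subgroups of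
  `H → A` under `hφ : ∀ h ∈ H, ∀ a, φ(h) a φ(h)⁻¹ = φ'(h) a φ'(h)⁻¹`;
* `ContH1.actionCongr hφ : ContH1 φ A H ≃* ContH1 φ' A H`, with `actionCongr_mk` (it is the identity on
  representing cocycles), `actionCongr_symm_mk`, and compatibility with restriction `res_actionCongr`;
  (v2) `actionCongr_refl`, `actionCongr_actionCongr`, naturality under pull-back `comap_actionCongr`, and
  the local forms `comap_section_comap'` (section hypothesis on the subgroup only) / `comap_injective_of_section`.

Used by the abc-iut cell's semi-synthetic ("χ-twisted") model of the [EtTh] §1 root (abc-iut-L2-lead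
gen 3 R78/R91) to identify `H¹(G_K̈, Δ_Θ)` computed through a Galois section with the classes on
`(Π^tp_Ÿ)^Θ` pulled back along the augmentation. Elementary; nothing of [EtTh] is asserted; no side is
taken on [IUTchIII] Cor. 3.12. Seat abc-iut-L2-t6 (gen 5).
-/

namespace Literature.AnabelianGeometry.EtaleTheta

open scoped IsMulCommutative

section ActionCongr

variable {G G' : Type*} [Group G] [TopologicalSpace G]
  [Group G'] [TopologicalSpace G'] [IsTopologicalGroup G']
  {φ φ' : G →* G'} {A : Subgroup G'} [A.Normal] [IsMulCommutative A] {H : Subgroup G}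
  (hφ : ∀ h : G, h ∈ H → ∀ a : A, MulAut.conjNormal (φ h) a = MulAut.conjNormal (φ' h) a)

include hφ

/-- Two action homomorphisms with the same conjugation on `A` over `H` have the same continuous
cocycles. [cite: NeukirchSchmidtWingberg2008, I §2 and II §7] -/
theorem contCocycles_congr : contCocycles φ A H = contCocycles φ' A H := by
  ext f
  simp only [mem_contCocycles_iff]
  refine and_congr_right fun _ => forall_congr' fun g => forall_congr' fun h => ?_
  rw [hφ g.1 g.2]

omit [TopologicalSpace G] [TopologicalSpace G'] [IsTopologicalGroup G'] in
/-- … and the same continuous coboundaries. [cite: NeukirchSchmidtWingberg2008, I §2 and II §7] -/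
theorem contCoboundaries_congr : contCoboundaries φ A H = contCoboundaries φ' A H := by
  ext f
  simp only [mem_contCoboundaries_iff]
  refine exists_congr fun a => ?_
  have : (fun h : H => MulAut.conjNormal (φ (h : G)) a * a⁻¹) =
      fun h : H => MulAut.conjNormal (φ' (h : G)) a * a⁻¹ :=
    funext fun h => by rw [hφ h.1 h.2]
  rw [this]

/-- The coboundary subgroups correspond under the identification of the cocycle groups.
[cite: NeukirchSchmidtWingberg2008, I §2 and II §7] -/
theorem map_subgroupCongr_contCoboundaries :
    ((contCoboundaries φ A H).subgroupOf (contCocycles φ A H)).map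
        (MulEquiv.subgroupCongr (contCocycles_congr hφ)).toMonoidHom =
      (contCoboundaries φ' A H).subgroupOf (contCocycles φ' A H) := by
  ext f
  simp only [Subgroup.mem_map, Subgroup.mem_subgroupOf, MulEquiv.coe_toMonoidHom]
  constructor
  · rintro ⟨g, hg, rfl⟩
    have : ((MulEquiv.subgroupCongr (contCocycles_congr hφ)) g : H → A) = (g : H → A) := rfl
    rw [this, ← contCoboundaries_congr hφ]
    exact hg
  · intro hf
    refine ⟨(MulEquiv.subgroupCongr (contCocycles_congr hφ)).symm f, ?_, MulEquiv.apply_symm_apply _ _⟩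
    have : (((MulEquiv.subgroupCongr (contCocycles_congr hφ)).symm f : contCocycles φ A H) : H → A) =
        (f : H → A) := rfl
    rw [this, contCoboundaries_congr hφ]
    exact hf

/-- **Transport of `H¹` along a change of action homomorphism with the same action**:
`ContH1 φ A H ≃* ContH1 φ' A H`, the identity on representing cocycles.
[cite: NeukirchSchmidtWingberg2008, I §2 and II §7] -/
noncomputable def ContH1.actionCongr : ContH1 φ A H ≃* ContH1 φ' A H :=
  QuotientGroup.congr _ _ (MulEquiv.subgroupCongr (contCocycles_congr hφ))
    (map_subgroupCongr_contCoboundaries hφ)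

/-- `actionCongr` is the identity on representing cocycles. [cite: NeukirchSchmidtWingberg2008, I §2 and II §7] -/
theorem ContH1.actionCongr_mk (f : H → A) (hf : f ∈ contCocycles φ A H) :
    ContH1.actionCongr hφ (ContH1.mk f hf) = ContH1.mk f ((contCocycles_congr hφ) ▸ hf) := rfl

/-- The inverse transport is the transport for the symmetric hypothesis, on representing cocycles.
[cite: NeukirchSchmidtWingberg2008, I §2 and II §7] -/
theorem ContH1.actionCongr_symm_mk (f : H → A) (hf : f ∈ contCocycles φ' A H) :
    (ContH1.actionCongr hφ).symm (ContH1.mk f hf) = ContH1.mk f ((contCocycles_congr hφ) ▸ hf) := by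
  rw [MulEquiv.symm_apply_eq]
  rfl

/-- Transport commutes with restriction to a smaller subgroup. [cite: NeukirchSchmidtWingberg2008, I §2 and II §7] -/
theorem ContH1.res_actionCongr {H₁ : Subgroup G} (hle : H₁ ≤ H) (x : ContH1 φ A H) :
    ContH1.res φ' A hle (ContH1.actionCongr hφ x) =
      ContH1.actionCongr (fun h hh a => hφ h (hle hh) a) (ContH1.res φ A hle x) := by
  induction x using QuotientGroup.induction_on with
  | H f => rfl

end ActionCongr

/-! ### Functoriality of the pull-back `ContH1.comap` and the section retraction -/

section ComapFunctoriality

variable {G₀ G₁ G G' : Type*} [Group G₀] [TopologicalSpace G₀] [Group G₁] [TopologicalSpace G₁]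
  [Group G] [TopologicalSpace G] [Group G'] [TopologicalSpace G'] [IsTopologicalGroup G']
  (φ : G →* G') (A : Subgroup G') [A.Normal] [IsMulCommutative A]
  (ι : G₁ →* G) (hι : Continuous ι) (κ : G₀ →* G₁) (hκ : Continuous κ)

/-- **Functoriality of the pull-back**: pulling back along `ι` and then along `κ` is pulling back along
`ι ∘ κ`. [cite: NeukirchSchmidtWingberg2008, I §2 and II §7] -/
theorem ContH1.comap_comap {H₀ : Subgroup G₀} {H₁ : Subgroup G₁} {H : Subgroup G}
    (h₁ : H₁.map ι ≤ H) (h₀ : H₀.map κ ≤ H₁) (x : ContH1 φ A H) :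
    ContH1.comap (φ.comp ι) A κ hκ h₀ (ContH1.comap φ A ι hι h₁ x) =
      ContH1.comap φ A (ι.comp κ) (hι.comp hκ)
        (by rw [← Subgroup.map_map]; exact (Subgroup.map_mono h₀).trans h₁) x := by
  induction x using QuotientGroup.induction_on with
  | H f => rfl

/-- Pulling back along the identity is the identity. [cite: NeukirchSchmidtWingberg2008, I §2 and II §7] -/
theorem ContH1.comap_id {H : Subgroup G} (x : ContH1 φ A H) :
    ContH1.comap φ A (MonoidHom.id G) continuous_id (by rw [Subgroup.map_id]) x = x := by
  induction x using QuotientGroup.induction_on with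
  | H f => rfl

/-- `ContH1.infl` (pull-back for the identity action on `G'`) IS `ContH1.comap` along the same map — the two
constructions of `ContH1.lean` / `ContH1CoeffChange.lean` agree definitionally (`(id).comp ψ = ψ` by eta).
[cite: NeukirchSchmidtWingberg2008, I §2 and II §7] -/
theorem ContH1.infl_eq_comap {G₀ G' : Type*} [Group G₀] [TopologicalSpace G₀] [Group G'] [TopologicalSpace G']
    [IsTopologicalGroup G'] (A : Subgroup G') [A.Normal] [IsMulCommutative A] (ψ : G₀ →* G')
    (hψ : Continuous ψ) {H₀ : Subgroup G₀} {H' : Subgroup G'} (h : H₀.map ψ ≤ H')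
    (x : ContH1 (MonoidHom.id G') A H') :
    ContH1.infl A ψ hψ h x = ContH1.comap (MonoidHom.id G') A ψ hψ h x := by
  induction x using QuotientGroup.induction_on with
  | H f => rfl

end ComapFunctoriality

section SectionRetraction

variable {G₀ G G' : Type*} [Group G₀] [TopologicalSpace G₀]
  [Group G] [TopologicalSpace G] [Group G'] [TopologicalSpace G'] [IsTopologicalGroup G']
  (φ₀ : G₀ →* G') (A : Subgroup G') [A.Normal] [IsMulCommutative A]
  (π : G →* G₀) (hπ : Continuous π) (s : G₀ →* G) (hs : Continuous s)
  (hsec : ∀ g : G₀, π (s g) = g)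

include hsec

omit [TopologicalSpace G₀] [TopologicalSpace G] [TopologicalSpace G'] [IsTopologicalGroup G']
  [IsMulCommutative A] in
/-- Along a SECTION `s` of `π` (`π ∘ s = id`) the action through `φ₀ ∘ π ∘ s` is the action through `φ₀`.
[cite: NeukirchSchmidtWingberg2008, I §2 and II §7] -/
theorem conjNormal_comp_section (h : G₀) (a : A) :
    MulAut.conjNormal (φ₀ h) a = MulAut.conjNormal (((φ₀.comp π).comp s) h) a := by
  simp only [MonoidHom.coe_comp, Function.comp_apply, hsec]

/-- **Section retraction**: for a continuous section `s : G₀ → G` of a continuous `π : G → G₀` and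
subgroups `H₀ ≤ G₀`, `H ≤ G` with `s(H₀) ≤ H`, `π(H) ≤ H₀`, pulling a class on `H₀` back to `H` along `π`
and then back to `H₀` along `s` returns the class (read through `actionCongr`, the action homomorphisms
`φ₀` and `φ₀ ∘ π ∘ s` having the same action). This is the mechanism of the EVALUATION map at a rational
point: `H¹(G_K̈, Δ_Θ) → H¹(D_y, Δ_Θ) → H¹(G_K̈, Δ_Θ)` is the identity ([EtTh] Prop. 1.4 (iii), p. 22: the
restricted Kummer class of a constant evaluates to the constant). [cite: NeukirchSchmidtWingberg2008, I §2 and II §7] -/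
theorem ContH1.comap_section_comap {H₀ : Subgroup G₀} {H : Subgroup G} (hH : H₀.map s ≤ H)
    (hH' : H.map π ≤ H₀) (x : ContH1 φ₀ A H₀) :
    ContH1.comap (φ₀.comp π) A s hs hH (ContH1.comap φ₀ A π hπ hH' x) =
      ContH1.actionCongr (H := H₀) (fun h _ a => conjNormal_comp_section φ₀ A π s hsec h a) x := by
  induction x using QuotientGroup.induction_on with
  | H f =>
    change ContH1.mk _ _ = ContH1.mk _ _
    refine ContH1.mk_congr H₀ (funext fun h => ?_) _ _
    change f.1 ⟨π (s h.1), _⟩ = f.1 h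
    exact congrArg f.1 (Subtype.ext (hsec h.1))

end SectionRetraction

/-! ### Naturality of the transport (appended by abc-iut-L2-t6 gen 5, v2) -/

section ActionCongrNaturality

variable {G₀ G G' : Type*} [Group G₀] [TopologicalSpace G₀] [Group G] [TopologicalSpace G]
  [Group G'] [TopologicalSpace G'] [IsTopologicalGroup G']
  {φ φ' φ'' : G →* G'} {A : Subgroup G'} [A.Normal] [IsMulCommutative A] {H : Subgroup G}

/-- The transport for the trivial change `φ = φ` is the identity. [cite: NeukirchSchmidtWingberg2008, I §2 and II §7] -/
theorem ContH1.actionCongr_refl (x : ContH1 φ A H) :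
    ContH1.actionCongr (φ := φ) (φ' := φ) (H := H) (fun _ _ _ => rfl) x = x := by
  induction x using QuotientGroup.induction_on with
  | H f => rfl

/-- Transports compose: `φ → φ' → φ''` equals `φ → φ''`. [cite: NeukirchSchmidtWingberg2008, I §2 and II §7] -/
theorem ContH1.actionCongr_actionCongr
    (h₁ : ∀ h : G, h ∈ H → ∀ a : A, MulAut.conjNormal (φ h) a = MulAut.conjNormal (φ' h) a)
    (h₂ : ∀ h : G, h ∈ H → ∀ a : A, MulAut.conjNormal (φ' h) a = MulAut.conjNormal (φ'' h) a)
    (x : ContH1 φ A H) :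
    ContH1.actionCongr h₂ (ContH1.actionCongr h₁ x) =
      ContH1.actionCongr (fun h hh a => (h₁ h hh a).trans (h₂ h hh a)) x := by
  induction x using QuotientGroup.induction_on with
  | H f => rfl

variable (ι : G₀ →* G) (hι : Continuous ι)

/-- **Naturality of the transport under pull-back**: transporting along `φ → φ'` and pulling back along
`ι` is pulling back and transporting along `φ ∘ ι → φ' ∘ ι`. [cite: NeukirchSchmidtWingberg2008, I §2 and II §7] -/
theorem ContH1.comap_actionCongr {H₀ : Subgroup G₀} (h : H₀.map ι ≤ H)
    (hφ : ∀ g : G, g ∈ H → ∀ a : A, MulAut.conjNormal (φ g) a = MulAut.conjNormal (φ' g) a)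
    (x : ContH1 φ A H) :
    ContH1.comap φ' A ι hι h (ContH1.actionCongr hφ x) =
      ContH1.actionCongr (φ := φ.comp ι) (φ' := φ'.comp ι) (H := H₀)
        (fun g hg a => hφ (ι g) (h ⟨g, hg, rfl⟩) a) (ContH1.comap φ A ι hι h x) := by
  induction x using QuotientGroup.induction_on with
  | H f => rfl

end ActionCongrNaturality

/-! ### The section retraction with the section hypothesis ON THE SUBGROUP ONLY (v2) -/

section SectionRetractionOn

variable {G₀ G G' : Type*} [Group G₀] [TopologicalSpace G₀]
  [Group G] [TopologicalSpace G] [Group G'] [TopologicalSpace G'] [IsTopologicalGroup G']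
  (φ₀ : G₀ →* G') (A : Subgroup G') [A.Normal] [IsMulCommutative A]
  (π : G →* G₀) (hπ : Continuous π) (s : G₀ →* G) (hs : Continuous s) {H₀ : Subgroup G₀}
  (hsec : ∀ g : G₀, g ∈ H₀ → π (s g) = g)

include hsec

omit [TopologicalSpace G₀] [TopologicalSpace G] [TopologicalSpace G'] [IsTopologicalGroup G']
  [IsMulCommutative A] in
/-- As `conjNormal_comp_section`, assuming `π ∘ s = id` on `H₀` only (e.g. `s ∘ aug = id` on a
section-subgroup `D_y = s(G_K̈)` although `s ∘ aug ≠ id` on `Π^tp`). [cite: NeukirchSchmidtWingberg2008, I §2 and II §7] -/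
theorem conjNormal_comp_section' (h : G₀) (hh : h ∈ H₀) (a : A) :
    MulAut.conjNormal (φ₀ h) a = MulAut.conjNormal (((φ₀.comp π).comp s) h) a := by
  simp only [MonoidHom.coe_comp, Function.comp_apply, hsec h hh]

/-- **Section retraction, local form**: as `ContH1.comap_section_comap` with the section hypothesis
`π (s g) = g` required for `g ∈ H₀` only. [cite: NeukirchSchmidtWingberg2008, I §2 and II §7] -/
theorem ContH1.comap_section_comap' {H : Subgroup G} (hH : H₀.map s ≤ H)
    (hH' : H.map π ≤ H₀) (x : ContH1 φ₀ A H₀) :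
    ContH1.comap (φ₀.comp π) A s hs hH (ContH1.comap φ₀ A π hπ hH' x) =
      ContH1.actionCongr (H := H₀) (fun h hh a => conjNormal_comp_section' φ₀ A π s hsec h hh a) x := by
  induction x using QuotientGroup.induction_on with
  | H f =>
    change ContH1.mk _ _ = ContH1.mk _ _
    refine ContH1.mk_congr H₀ (funext fun h => ?_) _ _
    change f.1 ⟨π (s h.1), _⟩ = f.1 h
    exact congrArg f.1 (Subtype.ext (hsec h.1 h.2))

include hs in
/-- Hence pulling back along `π` (from `H₀` to `H`) is INJECTIVE whenever `π` has a continuous section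
over `H₀` landing in `H`. [cite: NeukirchSchmidtWingberg2008, I §2 and II §7] -/
theorem ContH1.comap_injective_of_section {H : Subgroup G} (hH : H₀.map s ≤ H)
    (hH' : H.map π ≤ H₀) : Function.Injective (ContH1.comap φ₀ A π hπ hH' : ContH1 φ₀ A H₀ → _) := by
  intro x y hxy
  have h := congrArg (ContH1.comap (φ₀.comp π) A s hs hH) hxy
  rw [ContH1.comap_section_comap' φ₀ A π hπ s hs hsec hH hH',
    ContH1.comap_section_comap' φ₀ A π hπ s hs hsec hH hH'] at h
  exact (MulEquiv.injective _) h

end SectionRetractionOn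

end Literature.AnabelianGeometry.EtaleTheta
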